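import Summits.QuantumFields.BalabanUV.Beta.NVertexColumnK1Row
import Summits.QuantumFields.BalabanUV.Beta.KernelWardHColumn
import Summits.QuantumFields.BalabanUV.Beta.CompositeCorrectorLinear
import Summits.QuantumFields.BalabanUV.Beta.RelInvComposite
import Summits.QuantumFields.BalabanUV.Beta.NVertexWoundPeriodised
import Summits.QuantumFields.BalabanUV.Beta.CoDressedMmRead
import Summits.QuantumFields.BalabanUV.Beta.KernelWardMColumn

/-!
# `BalabanUV.Beta.FP.TowerNColumnWardLaw` — row D1 ∕ (C1) OWNER «beta-an2», PART 102, ROUTE T (β1), option (3a), toward the END's LAST F-side display `hW𝒯 j` (j ≥ 1):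
# **THE ℋ-COLUMN WARD LETTER (H) OF THE COMPOSITE ONE-SHOT CHART `AN R j` AT EVERY DOOR INDEX, BY NAME, WITH ITS CONSTANT `c_H = ((Lc^(j+1))⁴)⁻¹`**:
# `Σ_μ (colH (AN R j) (Lc^(j+1)) μ (y − e_μ) κ′ u − colH (AN R j) (Lc^(j+1)) μ y κ′ u) = ((Lc^(j+1))^(3+1))⁻¹ · gaugeWt (Lc^(j+1)) y κ′ u` (`colH_ward_AN`) —
# the socket `hH` of the generic coarse Ward END `FP/LetterInheritanceEnd.wardTransversal_flipK_hessKer_vertexOfK_of_letters` at the composite triple `(AN R j, VN, WN)`, whose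
# conclusion is the (3a) END's displayed `hW𝒯 j` (road skeletons W∕X, an2 W′).  WHY IT HOLDS: an2 g63 PART 22 `colH_AN_eq_corrPsi_colH_coDress` (the composite column is the
# corrector `Ψ̂_{j+1}` of the Π_bm-dressed straight column at block side `Lc^(j+1)`), an1 (W-LH) `KernelWardHColumn.colH_ward_of_AME` fed an2 `relInv_coDressKBmAt_KInv` (the dressed
# straight column's coarse divergence is `((Lc^(j+1))⁴)⁻¹ ·` the pure gauge `gaugeWt`), L1 linearity of `corrPsi`, and **`corrPsi` FIXES THE BLOCK PURE GAUGE**: `gaugeWt N y = dz (ext N δ_y)`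
# and `compDefectAt … (dz (ext (Lc^(j+1)) g)) = 0` (`compDefectAt_dz_ext_self`).  The other three letters of that END at the composite triple: (K) = an2 `RelInvComposite.relInv_composite`
# BY NAME (M := `bhKcomp R.rc Lc (j+1)`, E := `axEc (toSite (R.s (j+1))) (Lc^(j+1))`); (S), (W) = the composite TABLES' Ward laws — by value TEL2 C10 ∕ WARD (W2), by name open (the
# successor's series).  (β-function cell `pub-balaban`, BINDER-OWNERS row D1)

WHAT ([folklore]; 0 `def`): §1 `corrPsi_sub'`, `corrPsi_sum'`, `gaugeWt_eq_dz_ext`, `corrPsi_gaugeWt` (the corrector fixes `c • gaugeWt`); §2 `colH_coDress_ward` (the dressed straight column's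
law at block side `Lc^(j+1)`, an1 (W-LH) by name), **`colH_ward_AN`**, `hH_AN` (the END's socket shape with `cH := fun j => (((Lc^(j+1) : ℕ) : ℝ)^(3+1))⁻¹`); §3 (v2 APPEND) the chart half
PACKAGED: **`relInv_AN`** ((K) by name: an2 `relInv_composite`), `spr_bhKcomp`, `spr_axEc_AN`, `shiftK_AN_all`, `exists_decays_AN` (the END's `hR hM hE hKs hKd` sockets at the composite chart).
WHAT THIS IS NOT: not `hW𝒯` ((S)∕(W) displayed); nothing of the END instantiated; nothing of Bałaban's asserted, valued or discharged; 0 estimates; 0∕4 row-D1 binders; NOT (C1), NOT D1,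
NEVER «G-an2-4 closed», NOT BetaPertH, NOT continuum, NOT Clay.

HONEST DEPENDENCY (page 1, mandatory): continuum YM on T⁴ ⇐ BetaPertH ∧ nine spine estimates (0/9 proved); BetaPertH ⇐ (D1) ∧ (D4) ∧ CAP+tail;
G-an2-4 gates asym, D1 and NE2/3/4.  HONEST FRAMING (cell contract, verbatim): «discharging `BetaPertH` makes Bałaban's UV stability UNCONDITIONAL —
a real constructive-QFT result; it is NOT the continuum limit and NOT the Clay problem.»  ABSOLUTE RULE (cell charter, verbatim): «No internally-minted
statement may enter as a cited fact. Every hypothesis is either kernel-proved in this package or a verbatim quotation of a PUBLISHED theorem with page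
reference. The manuscript(s) under audit are NOT citable for their own disputed steps — they are the thing under adjudication; programme-internal
(2001/route/tribunal) claims are never citable.»  Row D1 ∕ (C1) OWNER «beta-an2», b2b-balaban-beta-an2 gen 85, 2026-08-30.  No existing file touched.
-/

noncomputable section

open Finset
open scoped BigOperators
open Literature.MathematicalPhysics.QuantumFieldTheory
open Literature.MathematicalPhysics.QuantumFieldTheory.Balaban1983to89
open Literature.MathematicalPhysics.QuantumFieldTheory.Balaban1983to89.Beta
open ExpKernelCalculus (MKer comp shiftK Decays)
open AffineAveraging (Form0 Form1 Site box toSite dz)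
open AveragingContours (blk)
open AveragingWardStencils (b6UnitVec_eq)
open OneStepResolventKernel (Fib KInv)
open OneStepKernelFamily (colH)
open Summit.QuantumFields.BalabanUV.Beta.TameKernelCalculus (Spr)
open Summit.QuantumFields.BalabanUV.Beta.ChartConjugationRelative (RelInv spr_comp)
open Summit.QuantumFields.BalabanUV.Beta.AxialDressingRooted (axEc spr_axEc coDressKBmAt spr_coDressKBmAt one_le_of_neZero)
open Summit.QuantumFields.BalabanUV.Beta.BorderedHessian (bhK spr_bhK spr_KInv relInv_coDressKBmAt_KInv)
open Summit.QuantumFields.BalabanUV.Beta.RelInvComposite (bhKcomp bhKcomp_eq relInv_composite)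
open Summit.QuantumFields.BalabanUV.Beta.CompositeCorrectorKernel (phiK spr_phiK)
open Summit.QuantumFields.BalabanUV.Beta.NVertexSectors (decays_AN)
open Summit.QuantumFields.BalabanUV.Beta.NVertexWoundPeriodised (shiftK_AN)
open Summit.QuantumFields.BalabanUV.Beta.KernelWardRelative (gaugeWt)
open Summit.QuantumFields.BalabanUV.Beta.KernelWardHColumn (colH_ward_of_AME)
open Summit.QuantumFields.BalabanUV.Beta.CompositeAveragingCoarseExact (compDefectAt)
open Summit.QuantumFields.BalabanUV.Beta.CompositeCorrectorForms (ext ext_apply corrPsi compDefectAt_dz_ext_self)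
open Summit.QuantumFields.BalabanUV.Beta.CompositeCorrectorLinear (corrPsi_add corrPsi_smul corrPsi_sum_smul)
open Summit.QuantumFields.BalabanUV.Beta.CompositeOneShotJetData (Roots AN)
open Summit.QuantumFields.BalabanUV.Beta.NVertexColumnK1Row (colH_AN_eq_corrPsi_colH_coDress)

namespace Summit.QuantumFields.BalabanUV.Beta.FP.TowerNColumnWardLaw

/-! ## §1 The corrector is linear and fixes block pure gauges -/

section Corrector

variable {d : ℕ}

/-- [folklore] `corrPsi` is subtractive (L1 `corrPsi_add` + `corrPsi_smul` at `−1`). -/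
theorem corrPsi_sub' (r : ℕ → (Fin d → ℕ)) (L m : ℕ) (A B : Form1 d ℝ) :
    corrPsi r L m (A - B) = corrPsi r L m A - corrPsi r L m B := by
  rw [sub_eq_add_neg, ← neg_one_smul ℝ B, corrPsi_add, corrPsi_smul, neg_one_smul, ← sub_eq_add_neg]

/-- [folklore] `corrPsi` commutes with finite sums (L1 `corrPsi_sum_smul` at unit weights). -/
theorem corrPsi_sum' {ι : Type*} (r : ℕ → (Fin d → ℕ)) (L m : ℕ) (s : Finset ι) (B : ι → Form1 d ℝ) :
    corrPsi r L m (∑ i ∈ s, B i) = ∑ i ∈ s, corrPsi r L m (B i) := by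
  have h := corrPsi_sum_smul r L m s (fun _ => (1 : ℝ)) B
  simp only [one_smul] at h
  exact h

/-- [folklore] **the pure-gauge weight is the fine gradient of the block-constant lift of the coarse delta**: `gaugeWt N y = dz (ext N δ_y)`. -/
theorem gaugeWt_eq_dz_ext (N : ℕ) (y : Fin (d + 1) → ℤ) :
    (fun κ' u => gaugeWt N y κ' u) = dz (ext N (fun q => if q = y then (1 : ℝ) else 0)) := by
  funext κ' u
  simp only [gaugeWt, dz, ext_apply, b6UnitVec_eq]

/-- [folklore] **THE CORRECTOR FIXES BLOCK PURE GAUGES**: `Ψ_m (c • gaugeWt (L^m) y) = c • gaugeWt (L^m) y` (in-block roots) — its defect potential kills exact forms of functions constant on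
`L^m`-blocks (`compDefectAt_dz_ext_self`). -/
theorem corrPsi_gaugeWt {L : ℕ} (hL : 0 < L) (r : ℕ → (Fin (d + 1) → ℕ)) (hr : ∀ k, r k ∈ box (d + 1) L) (m : ℕ) (c : ℝ) (y : Fin (d + 1) → ℤ) :
    corrPsi r L m (c • fun κ' u => gaugeWt (L ^ m) y κ' u) = c • fun κ' u => gaugeWt (L ^ m) y κ' u := by
  rw [corrPsi_smul, gaugeWt_eq_dz_ext]
  congr 1
  unfold corrPsi
  rw [compDefectAt_dz_ext_self hL r hr _ m]
  funext κ' u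
  simp only [Pi.add_apply, Pi.smul_apply, smul_eq_mul, dz, ext_apply, Pi.zero_apply, sub_self, mul_zero, add_zero]

end Corrector

/-! ## §2 The composite chart's ℋ-column Ward law -/

section Column

variable (Lc : ℕ) [NeZero Lc] (R : Roots Lc)

/-- [folklore] **(W-LH) FOR THE Π_bm-DRESSED STRAIGHT COLUMN AT BLOCK SIDE `Lc^(j+1)`** (an1 `colH_ward_of_AME` fed an2 `relInv_coDressKBmAt_KInv`'s rule AME): coarse divergence
`= ((Lc^(j+1))^(3+1))⁻¹ · gaugeWt`. -/
theorem colH_coDress_ward (j : ℕ) (y : Site (3 + 1)) (κ' : Fin (3 + 1)) (u : Site (3 + 1)) :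
    ∑ μ, (colH (coDressKBmAt (toSite (R.s (j + 1))) (Lc ^ (j + 1)) (KInv (N := Lc ^ (j + 1)) (d := 3))) (Lc ^ (j + 1)) μ (y - B6BondElimination.unitVec μ) κ' u
        - colH (coDressKBmAt (toSite (R.s (j + 1))) (Lc ^ (j + 1)) (KInv (N := Lc ^ (j + 1)) (d := 3))) (Lc ^ (j + 1)) μ y κ' u)
      = ((((Lc ^ (j + 1) : ℕ) : ℝ)) ^ (3 + 1))⁻¹ * gaugeWt (Lc ^ (j + 1)) y κ' u :=
  colH_ward_of_AME (spr_coDressKBmAt (one_le_of_neZero (Lc ^ (j + 1))) (R.hs (j + 1)) spr_KInv) (relInv_coDressKBmAt_KInv (R.hs (j + 1))).AME y κ' u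

/-- [folklore] **`colH_ward_AN` — THE LETTER (H) OF THE COARSE WARD END AT THE COMPOSITE CHART, EVERY DOOR INDEX `j`, EVERY ROOT FAMILY `R`:**
`Σ_μ (colH (AN R j) (Lc^(j+1)) μ (y − e_μ) κ′ u − colH (AN R j) (Lc^(j+1)) μ y κ′ u) = ((Lc^(j+1))^(3+1))⁻¹ · gaugeWt (Lc^(j+1)) y κ′ u`. -/
theorem colH_ward_AN (j : ℕ) (y : Site (3 + 1)) (κ' : Fin (3 + 1)) (u : Site (3 + 1)) :
    ∑ μ, (colH (AN R j) (Lc ^ (j + 1)) μ (y - B6BondElimination.unitVec μ) κ' u - colH (AN R j) (Lc ^ (j + 1)) μ y κ' u)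
      = ((((Lc ^ (j + 1) : ℕ) : ℝ)) ^ (3 + 1))⁻¹ * gaugeWt (Lc ^ (j + 1)) y κ' u := by
  have hLc : 0 < Lc := Nat.pos_of_ne_zero (NeZero.ne Lc)
  -- the dressed straight column family and its law as ONE identity of 1-forms
  set G : MKer (3 + 1) (Fib 3) := coDressKBmAt (toSite (R.s (j + 1))) (Lc ^ (j + 1)) (KInv (N := Lc ^ (j + 1)) (d := 3)) with hG
  have hlaw : (∑ μ, (colH G (Lc ^ (j + 1)) μ (y - B6BondElimination.unitVec μ) - colH G (Lc ^ (j + 1)) μ y))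
      = ((((Lc ^ (j + 1) : ℕ) : ℝ)) ^ (3 + 1))⁻¹ • fun κ₁ u₁ => gaugeWt (Lc ^ (j + 1)) y κ₁ u₁ := by
    funext κ₁ u₁
    rw [Finset.sum_apply, Finset.sum_apply]
    simp only [Pi.sub_apply, Pi.smul_apply, smul_eq_mul]
    exact colH_coDress_ward Lc R j y κ₁ u₁
  -- the composite column is the corrector of the dressed straight column
  have hcol : ∀ (μ : Fin (3 + 1)) (y' : Site (3 + 1)), colH (AN R j) (Lc ^ (j + 1)) μ y' = corrPsi R.rc Lc (j + 1) (colH G (Lc ^ (j + 1)) μ y') :=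
    fun μ y' => colH_AN_eq_corrPsi_colH_coDress R j μ y'
  have hsum : (∑ μ, (colH (AN R j) (Lc ^ (j + 1)) μ (y - B6BondElimination.unitVec μ) - colH (AN R j) (Lc ^ (j + 1)) μ y))
      = corrPsi R.rc Lc (j + 1) (∑ μ, (colH G (Lc ^ (j + 1)) μ (y - B6BondElimination.unitVec μ) - colH G (Lc ^ (j + 1)) μ y)) := by
    rw [corrPsi_sum']
    refine Finset.sum_congr rfl fun μ _ => ?_
    rw [corrPsi_sub', hcol, hcol]
  have happ := congrFun (congrFun hsum κ') u
  rw [Finset.sum_apply, Finset.sum_apply] at happ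
  simp only [Pi.sub_apply] at happ
  rw [happ, hlaw, corrPsi_gaugeWt hLc R.rc R.hrc (j + 1)]
  simp only [Pi.smul_apply, smul_eq_mul]

/-- [folklore] **`hH_AN` — THE END's SOCKET SHAPE**: with `cH := fun j => (((Lc^(j+1) : ℕ) : ℝ)^(3+1))⁻¹`, `∀ j y κ′ u, Σ_μ (…) = cH j * gaugeWt (Lc^(j+1)) y κ′ u`. -/
theorem hH_AN : ∀ (j : ℕ) (y : Site (3 + 1)) (κ' : Fin (3 + 1)) (u : Site (3 + 1)),
    ∑ μ, (colH (AN R j) (Lc ^ (j + 1)) μ (y - B6BondElimination.unitVec μ) κ' u - colH (AN R j) (Lc ^ (j + 1)) μ y κ' u)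
      = (fun j : ℕ => ((((Lc ^ (j + 1) : ℕ) : ℝ)) ^ (3 + 1))⁻¹) j * gaugeWt (Lc ^ (j + 1)) y κ' u :=
  fun j y κ' u => colH_ward_AN Lc R j y κ' u

end Column

/-! ## §3 (v2 APPEND) The chart half of the coarse Ward END at the composite triple, packaged: letter (K) and the chart's own sockets -/

section ChartLetters

variable (Lc : ℕ) [NeZero Lc] (R : Roots Lc)

/-- [folklore] **(K) AT THE COMPOSITE CHART, BY NAME**: `RelInv (AN R j) (bhKcomp R.rc Lc (j+1)) (axEc (toSite (R.s (j+1))) (Lc^(j+1)))` — an2 `RelInvComposite.relInv_composite` read through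
`CompositeOneShotJetData.AN_eq` (`AN R j = compChart R.rc Lc (j+1) (R.s (j+1)) (Lc^(j+1)) = Ψ ∘ Π_bm-dressed `KInv` ∘ Ψᵀ`). -/
theorem relInv_AN (j : ℕ) :
    RelInv (AN R j) (bhKcomp (d := 3) R.rc Lc (j + 1)) (axEc (toSite (R.s (j + 1))) (Lc ^ (j + 1))) := by
  rw [CompositeOneShotJetData.AN_eq]
  exact relInv_composite (Nat.pos_of_ne_zero (NeZero.ne Lc)) R.rc R.hrc (R.hs (j + 1))

/-- [folklore] the END's `hM` socket: the conjugated bordered Hessian `bhKcomp` is spread (`bhKcomp_eq`, `spr_phiK`, `spr_bhK`, `spr_comp`, `Spr.trK`). -/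
theorem spr_bhKcomp (j : ℕ) : Spr (bhKcomp (d := 3) R.rc Lc (j + 1)) := by
  have hLc : 0 < Lc := Nat.pos_of_ne_zero (NeZero.ne Lc)
  rw [bhKcomp_eq]
  exact spr_comp (spr_comp (spr_phiK hLc R.hrc (j + 1)).trK (spr_bhK (one_le_of_neZero (Lc ^ (j + 1))))) (spr_phiK hLc R.hrc (j + 1))

omit [NeZero Lc] in
/-- [folklore] the END's `hE` socket: `Spr (axEc (toSite (R.s (j+1))) (Lc^(j+1)))` (an2 `spr_axEc`). -/
theorem spr_axEc_AN (j : ℕ) : Spr (axEc (toSite (R.s (j + 1))) (Lc ^ (j + 1))) := spr_axEc _ _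

/-- [folklore] the END's `hKs` socket: the composite chart is `Lc^(j+1)`-block covariant (an2 `shiftK_AN`). -/
theorem shiftK_AN_all (j : ℕ) : ∀ t : Fin (3 + 1) → ℤ, shiftK (-(((Lc ^ (j + 1) : ℕ) : ℤ) • t)) (AN R j) = AN R j :=
  fun t => by rw [CompositeOneShotJetData.AN_eq]; exact shiftK_AN R j 0 t

/-- [folklore] the END's `hKd`∕`hδK` sockets: the composite chart decays with a positive rate (an2 `decays_AN`, repackaged as `∃ C δ, 0 < δ ∧ Decays …`). -/
theorem exists_decays_AN (j : ℕ) : ∃ C δ : ℝ, 0 < δ ∧ Decays (AN R j) C δ := by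
  obtain ⟨δ, C, hδ, -, h⟩ := decays_AN R j
  exact ⟨C, δ, hδ, h⟩

end ChartLetters

/-! ## §4 (row D1 owner an2 gen 86, PART 107 — APPEND) The composite chart's MULTIPLIER column: the END's `hMw` and `hoff` letters for `AN R j`, by name -/

section MultiplierColumn

variable (Lc : ℕ) [NeZero Lc] (R : Roots Lc)

/-- [folklore] **THE MULTIPLIER–MULTIPLIER BLOCK OF THE COMPOSITE CHART IS THE STRAIGHT ONE-SHOT's**: `AN R j x z (inr ρ) (inr μ) = KInv (Lc^(j+1)) x z (inr ρ) (inr μ)` — the corrector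
`Ψ̂` and the block-mean dressing `Π_bm` fix multiplier indices (`comp_trK_psiK_inr`, `comp_psiK_inr`, `coDressKBmAt_inr_inr`). -/
theorem AN_inr_inr (j : ℕ) (x z : Site (3 + 1)) (ρ μ : Fin (3 + 1)) :
    AN R j x z (Sum.inr ρ) (Sum.inr μ) = KInv (N := Lc ^ (j + 1)) (d := 3) x z (Sum.inr ρ) (Sum.inr μ) := by
  rw [CompositeOneShotJetData.AN_eq]
  unfold CompositeCorrectorDress.compChart
  rw [CompositeCorrectorKernel.comp_trK_psiK_inr, CompositeCorrectorKernel.comp_psiK_inr, AxialDressingRooted.coDressKBmAt_inr_inr]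

/-- [folklore] **THE MULTIPLIER COLUMN OF THE COMPOSITE CHART IS THE STRAIGHT SYSTEM's MULTIPLIER RESPONSE**: `colM (AN R j) (Lc^(j+1)) μ y ρ w = wΦ ρ μ (w − y)` (lit `KInv_inr_inr_coarse`). -/
theorem colM_AN (j : ℕ) (μ : Fin (3 + 1)) (y : Site (3 + 1)) (ρ : Fin (3 + 1)) (w : Site (3 + 1)) :
    SecondOrderResponse.colM (AN R j) (Lc ^ (j + 1)) μ y ρ w = KernelSpecInstance.wΦ (N := Lc ^ (j + 1)) ρ μ (w - y) := by
  unfold SecondOrderResponse.colM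
  rw [AN_inr_inr, OneStepResolventKernel.KInv_inr_inr_coarse]

/-- [folklore] **(hMw) FOR THE COMPOSITE CHART — THE MULTIPLIER-COLUMN WARD LAW, SOURCE SLOT, EVERY DOOR INDEX**:
`Σ_μ (colM (AN R j) N μ (y − e_μ) ρ w − colM (AN R j) N μ y ρ w) = 0` (an2 `KernelWardMColumn.wΦ_ward_source`) — the socket `hMw` of an2 g29's
`WardLocusRecursiveAllSlot.divW_WrecOf_zero_of_letters` at the composite triple. -/
theorem colM_ward_AN (j : ℕ) (y : Site (3 + 1)) (ρ : Fin (3 + 1)) (w : Site (3 + 1)) :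
    ∑ μ : Fin (3 + 1), (SecondOrderResponse.colM (AN R j) (Lc ^ (j + 1)) μ (y - B6BondElimination.unitVec μ) ρ w -
        SecondOrderResponse.colM (AN R j) (Lc ^ (j + 1)) μ y ρ w) = 0 := by
  simp only [colM_AN]
  exact KernelWardMColumn.wΦ_ward_source (N := Lc ^ (j + 1)) ρ w y

/-- [folklore] (hMw, response slot) for the composite chart (an2 `wΦ_ward_resp`). -/
theorem colM_ward_resp_AN (j : ℕ) (μ : Fin (3 + 1)) (y w : Site (3 + 1)) :
    ∑ ρ : Fin (3 + 1), (SecondOrderResponse.colM (AN R j) (Lc ^ (j + 1)) μ y ρ (w - B6BondElimination.unitVec ρ) -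
        SecondOrderResponse.colM (AN R j) (Lc ^ (j + 1)) μ y ρ w) = 0 := by
  simp only [colM_AN]
  exact KernelWardMColumn.wΦ_ward_resp (N := Lc ^ (j + 1)) μ w y

/-- [folklore] **(hoff) FOR THE COMPOSITE CHART**: off the coarse lattice the multiplier rows vanish — `proj (Lc^(j+1)) x ≠ 0 → AN R j x z (inr ρ) (inr μ) = 0` (lit `KInv_inr_off`). -/
theorem AN_inr_inr_off (j : ℕ) {x : Site (3 + 1)} (hx : Literature.Probability.LatticeModels.Torus.proj (Lc ^ (j + 1)) x ≠ 0) (z : Site (3 + 1))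
    (ρ μ : Fin (3 + 1)) : AN R j x z (Sum.inr ρ) (Sum.inr μ) = 0 := by
  rw [AN_inr_inr, OneStepResolventKernel.KInv_inr_off hx]

end MultiplierColumn

end Summit.QuantumFields.BalabanUV.Beta.FP.TowerNColumnWardLaw

end
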